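import Summits.Ventures.CertifiedArithmetic.Expansions.Orient2dStageBBounds
import Mathlib.Tactic.Linarith
import Mathlib.Tactic.Positivity
import Mathlib.Tactic.Ring
import Mathlib.Tactic.NormNum

/-!
# INCIRCLE, stage B, part 1b: which constants the stage-B analysis certifies

NEW WORK in the sense of this development (companion of `IncircleStageBBounds.lean`, whose theorem
`incircle_stageB_sign_of_bounds` needs THE MARGIN
`(1 + δ)(4ε + 18ε² + 34ε³ + 35ε⁴ + 21ε⁵ + 7ε⁶ + ε⁷) < (1 − ε)⁵·K` for the errbound coefficient
`K` and ESTIMATE's relative error `δ`; with `K = (4 + Cε)ε`, `δ = kε` the margin is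
`ε²(C − 38 − 4k) + O(ε³)`) — the INCIRCLE twin of `Orient3dStageBMargins.lean`.

THE FINDING (about constants, not about the C code).  (a) With the estimate error PROVED in this
development for every weakly nonoverlapping expansion, `δ = 3u` (`EstimateRelativeError.lean`), the
margin needs `C > 50`: `iccerrboundB56_margin` certifies `K = (4 + 56ε)ε` for `0 < ε ≤ 1/64`
(`p ≥ 6`, the precision floor of stage A anyway; exact polynomial
`ε²(6 − 328ε + 383ε² − 666ε³ + 206ε⁴ − 78ε⁵ − 3ε⁶)`; for the record `C = 52` needs `p ≥ 8`,
`C = 54` needs `p ≥ 7`, `C = 51` needs `p ≥ 9`, `C ≤ 50` never closes).  (b) Shewchuk's published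
`iccerrboundB = (4 + 48ε)ε` (Table 5 p. 352, line B; `predicates.c`) closes this margin only for
`k < 5/2`; under his claimed estimate error `k = 2` (p. 349 with p. 333, see the ORIENT3D twin)
`iccerrboundB_margin_of_two` certifies it for `0 < ε ≤ 1/256` — `p ≥ 8`, NOT `p ≥ 6, 7`: the exact
polynomial `ε²(2 − 270ε + 337ε² − 551ε³ + 187ε⁴ − 63ε⁵ − 2ε⁶)` is negative at `ε = 2^−7`
(irrelevant at `p = 53`, recorded because the ORIENT3D constant closes from `p ≥ 7`).  As for
ORIENT3D, `k = 2` is not available to us (exhaustive exact-model evidence recorded with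
`EstimateRelativeError.lean`: round-to-nearest-even estimation overshoots by `2.30ε|B|` at `p = 6`),
so the stage-B soundness theorem of this development will carry `iccerrboundB56 = (4 + 56ε)ε`,
`p ≥ 6`.  NOTHING is claimed about `predicates.c` returning a wrong sign — OPEN, as for ORIENT3D.

Contents: the two margins; `unitRoundoff_le_256_of_eight_le` (`u ≤ 1/64` for `p ≥ 6` is
`Literature…Shewchuk1997.unitRoundoff_le_of_six_le` of `Orient3dStageA`); the constants
`iccerrboundB` (Shewchuk's, for the record) and `iccerrboundB56`, their grid `2^(−2p)ℤ`, and
`isFloat_iccerrboundB56`.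
References: J. R. Shewchuk, Discrete Comput. Geom. 18 (1997) 305–363, §4.4 Table 5 p. 352, §4.3
p. 349, §2.7 p. 333; `predicates.c` (`exactinit`, `incircleadapt`) [Shewchuk1997].
-/

namespace Summit.Ventures.CertifiedArithmetic.Expansions

open Literature.ComputerArithmetic.JeannerodRump2018
open Literature.ComputerArithmetic.BoldoJeannerodMelquiondMuller2023 hiding twoSum twoSum_fst
  isFloat_twoSum
open Literature.ComputerArithmetic.Shewchuk1997

variable {p : ℕ} {emin : ℤ}

/-! ## The margins -/

/-- **The margin with the PROVED estimate error `δ = 3ε` and the constant `(4 + 56ε)ε`**: for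
`0 < ε ≤ 1/64` (`p ≥ 6`), `(1 + 3ε)(4ε + 18ε² + … + ε⁷) < (1 − ε)⁵(4 + 56ε)ε`, the difference
being `ε²(6 − 328ε + 383ε² − 666ε³ + 206ε⁴ − 78ε⁵ − 3ε⁶)` with `6 − 328ε ≥ 6 − 328/64 > 0`,
`383ε² ≥ 666ε³`, `206ε⁴ ≥ 78ε⁵ + 3ε⁶`. -/
theorem iccerrboundB56_margin {u : ℚ} (hu0 : 0 < u) (hu : u ≤ 1 / 64) :
    (1 + 3 * u) * (4 * u + 18 * u ^ 2 + 34 * u ^ 3 + 35 * u ^ 4 + 21 * u ^ 5 + 7 * u ^ 6 + u ^ 7)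
      < (1 - u) ^ 5 * ((4 + 56 * u) * u) := by
  have hkey : (1 - u) ^ 5 * ((4 + 56 * u) * u) - (1 + 3 * u) * (4 * u + 18 * u ^ 2 + 34 * u ^ 3
      + 35 * u ^ 4 + 21 * u ^ 5 + 7 * u ^ 6 + u ^ 7) = u ^ 2 * (6 - 328 * u + 383 * u ^ 2
      - 666 * u ^ 3 + 206 * u ^ 4 - 78 * u ^ 5 - 3 * u ^ 6) := by
    ring
  have h1 : 0 < 6 - 328 * u := by linarith
  have h2 : 0 ≤ 383 * u ^ 2 - 666 * u ^ 3 := by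
    have h : 0 ≤ 383 - 666 * u := by linarith
    have := mul_nonneg (pow_nonneg hu0.le 2) h
    linarith
  have h3 : 0 ≤ 206 * u ^ 4 - 78 * u ^ 5 - 3 * u ^ 6 := by
    have hu2 : u ^ 2 ≤ 1 := by nlinarith
    have h : 0 ≤ 206 - 78 * u - 3 * u ^ 2 := by linarith
    have := mul_nonneg (pow_nonneg hu0.le 4) h
    linarith
  have hpoly : 0 < 6 - 328 * u + 383 * u ^ 2 - 666 * u ^ 3 + 206 * u ^ 4 - 78 * u ^ 5
      - 3 * u ^ 6 := by
    linarith
  have := mul_pos (pow_pos hu0 2) hpoly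
  rw [← hkey] at this
  linarith

/-- **Shewchuk's constant under Shewchuk's estimate bound**: IF the estimate error were `δ = 2ε`,
then `(4 + 48ε)ε` would close the margin for `0 < ε ≤ 1/256` (`p ≥ 8`): the difference is
`ε²(2 − 270ε + 337ε² − 551ε³ + 187ε⁴ − 63ε⁵ − 2ε⁶)` (negative at `ε = 1/128`).  Recorded to pin down
what Table 5, line B rests on; `δ = 2ε` is not available (see the module docstring). -/
theorem iccerrboundB_margin_of_two {u : ℚ} (hu0 : 0 < u) (hu : u ≤ 1 / 256) :
    (1 + 2 * u) * (4 * u + 18 * u ^ 2 + 34 * u ^ 3 + 35 * u ^ 4 + 21 * u ^ 5 + 7 * u ^ 6 + u ^ 7)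
      < (1 - u) ^ 5 * ((4 + 48 * u) * u) := by
  have hkey : (1 - u) ^ 5 * ((4 + 48 * u) * u) - (1 + 2 * u) * (4 * u + 18 * u ^ 2 + 34 * u ^ 3
      + 35 * u ^ 4 + 21 * u ^ 5 + 7 * u ^ 6 + u ^ 7) = u ^ 2 * (2 - 270 * u + 337 * u ^ 2
      - 551 * u ^ 3 + 187 * u ^ 4 - 63 * u ^ 5 - 2 * u ^ 6) := by
    ring
  have h1 : 0 < 2 - 270 * u := by linarith
  have h2 : 0 ≤ 337 * u ^ 2 - 551 * u ^ 3 := by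
    have h : 0 ≤ 337 - 551 * u := by linarith
    have := mul_nonneg (pow_nonneg hu0.le 2) h
    linarith
  have h3 : 0 ≤ 187 * u ^ 4 - 63 * u ^ 5 - 2 * u ^ 6 := by
    have hu2 : u ^ 2 ≤ 1 := by nlinarith
    have h : 0 ≤ 187 - 63 * u - 2 * u ^ 2 := by linarith
    have := mul_nonneg (pow_nonneg hu0.le 4) h
    linarith
  have hpoly : 0 < 2 - 270 * u + 337 * u ^ 2 - 551 * u ^ 3 + 187 * u ^ 4 - 63 * u ^ 5
      - 2 * u ^ 6 := by
    linarith
  have := mul_pos (pow_pos hu0 2) hpoly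
  rw [← hkey] at this
  linarith

/-- `u = 2^−p ≤ 1/256` for `p ≥ 8`. -/
theorem unitRoundoff_le_256_of_eight_le (hp : 8 ≤ p) : unitRoundoff p ≤ 1 / 256 := by
  unfold unitRoundoff
  have h : (256 : ℚ) ≤ 2 ^ p := by
    calc (256 : ℚ) = 2 ^ 8 := by norm_num
      _ ≤ 2 ^ p := pow_le_pow_right₀ (by norm_num) hp
  exact one_div_le_one_div_of_le (by norm_num) h

/-! ## The constants -/

/-- Shewchuk's coefficient of Table 5, line B (`predicates.c` `exactinit`:
`iccerrboundB = (4.0 + 48.0 * epsilon) * epsilon`).  Recorded for reference; NOT certified by the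
analysis of this development with the estimate error available to us (module docstring). -/
def iccerrboundB (p : ℕ) : ℚ := (4 + 48 * unitRoundoff p) * unitRoundoff p

/-- The coefficient this development certifies for INCIRCLE's stage-B test with `δ = 3u`, `p ≥ 6`:
`(4 + 56ε)ε` (representable: `(2^(p−1) + 7)·2^(3−2p)`, `isFloat_iccerrboundB56`). -/
def iccerrboundB56 (p : ℕ) : ℚ := (4 + 56 * unitRoundoff p) * unitRoundoff p

/-- `iccerrboundB = (4·2^p + 48)·2^(−2p)` lies on the grid `2^(−2p) ℤ`. -/
theorem onGrid_iccerrboundB (p : ℕ) : OnGrid (-(2 * (p : ℤ))) (iccerrboundB p) := by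
  refine ⟨4 * 2 ^ p + 48, ?_⟩
  unfold iccerrboundB unitRoundoff
  have h2 : (2 : ℚ) ^ p ≠ 0 := pow_ne_zero _ (by norm_num)
  rw [show (-(2 * (p : ℤ))) = -((p : ℤ) + (p : ℤ)) by ring, zpow_neg, zpow_add₀ (by norm_num),
    zpow_natCast]
  push_cast
  field_simp

/-- `iccerrboundB56 = (4·2^p + 56)·2^(−2p)` lies on the grid `2^(−2p) ℤ`. -/
theorem onGrid_iccerrboundB56 (p : ℕ) : OnGrid (-(2 * (p : ℤ))) (iccerrboundB56 p) := by
  refine ⟨4 * 2 ^ p + 56, ?_⟩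
  unfold iccerrboundB56 unitRoundoff
  have h2 : (2 : ℚ) ^ p ≠ 0 := pow_ne_zero _ (by norm_num)
  rw [show (-(2 * (p : ℤ))) = -((p : ℤ) + (p : ℤ)) by ring, zpow_neg, zpow_add₀ (by norm_num),
    zpow_natCast]
  push_cast
  field_simp

/-- `iccerrboundB56 = (2^(p−1) + 7)·2^(3−2p)` is a float of `F(p, emin)` for `p ≥ 4` and
`emin ≤ 3 − 2p`. -/
theorem isFloat_iccerrboundB56 (hp : 4 ≤ p) (hemin : emin ≤ 3 - 2 * (p : ℤ)) :
    IsFloat p emin (iccerrboundB56 p) := by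
  refine ⟨2 ^ (p - 1) + 7, 3 - 2 * (p : ℤ), ?_, hemin, ?_⟩
  · have habs : |(2 : ℤ) ^ (p - 1) + 7| = 2 ^ (p - 1) + 7 := abs_of_nonneg (by positivity)
    rw [habs]
    have h3 : (8 : ℤ) ≤ 2 ^ (p - 1) := by
      calc (8 : ℤ) = 2 ^ 3 := by norm_num
        _ ≤ 2 ^ (p - 1) := pow_le_pow_right₀ (by norm_num) (by omega)
    calc (2 : ℤ) ^ (p - 1) + 7 < 2 ^ (p - 1) + 2 ^ (p - 1) := by linarith
      _ = 2 ^ (p - 1 + 1) := by ring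
      _ = 2 ^ p := by congr 1; omega
  · unfold iccerrboundB56 unitRoundoff
    have h2 : (2 : ℚ) ≠ 0 := by norm_num
    rw [show (3 - 2 * (p : ℤ)) = -(((p - 1 : ℕ) : ℤ)) + (-(((p - 1 : ℕ) : ℤ)) + 1) by omega,
      zpow_add₀ h2, zpow_add₀ h2, zpow_neg, zpow_natCast, zpow_one,
      show (2 : ℚ) ^ p = 2 ^ (p - 1) * 2 by rw [← pow_succ]; congr 1; omega]
    push_cast
    field_simp
    ring

end Summit.Ventures.CertifiedArithmetic.Expansions
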